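import Summits.KontsevichZagierPeriods.Zeta5Search.Barrier.ConeGammaLine75Phi

/-!
# ζ(5) search — BARRIER (ii), bookkeeping: the CERTIFIED FLOOR of every cone sup bound, in the `ConeSupBound` / `BarrierC2` vocabulary

HONEST FRAMING (cell `pub-zeta5`): systematic search; no irrationality claim unless kernel-certified. Everything here is the
MODEL — Brown–Zudilin's closed-form rates under their own denominator accounting ((28) observed, (29)–(30) on top;
[BZ22] = arXiv:2210.03391); nothing is a theorem about `ζ(5)`; every `γ` is `< 1` with a positive two-term margin `S*` (no
irrationality content); records in print UNMOVED. Seat P2 g18 (2026-08-26), Lean-only, 0 kit.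

This file contains NO new number and NO new definition. It restates, in the vocabulary of the barrier statement
`ConeSupBound γ* := ∀ a ∈ BZCone, Regular a → γ(a) ≤ γ*` and of the cell's typed conjecture `BarrierC2 := ∃ γ* < 1,
ConeSupBound γ*` (`ConeGammaRates`), what the tree already proves UNCONDITIONALLY about ONE lattice direction — the
witness `line75Dir = (28,58,38,54,44,56,62,48)` (class `150; 22,34,42,46,54,58,66`, the primitive `75; 11,17,21,23,27,29,33`):
`line75Dir ∈ BZCone` (`Line75Ray.line75Dir_mem_BZCone`), `Regular line75Dir` (`Line75Ray.regular_line75Dir`) and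
`γ(line75Dir) ∈ (0.870141, 0.870142)` with NO `hΦ` hypothesis (`Line75Ray.gamma_line75Dir_mem_unconditional`, the 8/8 pin chain
P2 g14–g17). Consequences, all one-liners:

* `ConeSupBound.mono` — valid sup bounds form an upper set;
* `ConeSupBound.lt_of_witness` — any certified regular cone direction is a floor for every sup bound;
* **`ConeSupBound.floor`** — `ConeSupBound γ* → 0.870141 < γ*`: the kernel form of the LOWER half of the headline of record
  «`0.8701415 ≤ sup γ_28`» (BARRIER-PLAN LEAD ADDENDUM 12 (O3) / 15 (R6));
* **`not_coneSupBound_087`** — `¬ ConeSupBound 0.87`: the kernel form of «the cell wording ‹sup < 0.87› is FALSIFIED at the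
  MODEL tier» (ADDENDUM 12), and `not_coneSupBound_0867` for the coordinator's earlier numerical target `0.867`;
* `barrierC2_iff_exists_Ioo` — C2 now reads `∃ γ* ∈ (0.870141, 1), ConeSupBound γ*`; `not_barrierC2_iff` — its negation is
  «for every `γ* < 1` some regular cone direction has `γ > γ*`» (i.e. `sup = 1`), stated for the refuter side.

`BarrierC2` itself is UNAFFECTED and remains OPEN: no upper bound below `1` on the cone is claimed anywhere in the tree.
-/

namespace Summit.KontsevichZagierPeriods.Zeta5Search.Barrier.ConeGamma

open Set

/-- Valid cone sup bounds form an UPPER SET: `γ* ≤ γ*'` and `ConeSupBound γ*` give `ConeSupBound γ*'`. -/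
theorem ConeSupBound.mono {γs γs' : ℝ} (h : ConeSupBound γs) (hle : γs ≤ γs') : ConeSupBound γs' :=
  fun a ha hr => (h a ha hr).trans hle

/-- A certified value at ONE regular direction of the cone is a floor for EVERY cone sup bound:
`a ∈ BZCone`, `Regular a`, `c < γ(a)` and `ConeSupBound γ*` give `c < γ*`. -/
theorem ConeSupBound.lt_of_witness {γs c : ℝ} (h : ConeSupBound γs) {a : Dir} (ha : a ∈ BZCone) (hr : Regular a)
    (hc : c < gamma a) : c < γs :=
  hc.trans_le (h a ha hr)

/-- Every cone sup bound bounds the witness direction's MODEL rate: `ConeSupBound γ* → γ(line75) ≤ γ*`. -/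
theorem ConeSupBound.gamma_line75Dir_le {γs : ℝ} (h : ConeSupBound γs) : gamma Line75Ray.line75Dir ≤ γs :=
  h _ Line75Ray.line75Dir_mem_BZCone Line75Ray.regular_line75Dir

/-- **THE CERTIFIED FLOOR (kernel form of «`0.8701415 ≤ sup γ_28`», the lower half of the headline of record)**:
every `γ*` with `ConeSupBound γ*` satisfies `0.870141 < γ*` — because the witness direction `line75Dir` is a regular point of
the cone with `γ(line75Dir) > 0.870141` UNCONDITIONALLY (`Line75Ray.gamma_line75Dir_mem_unconditional`). MODEL statement under
BZ (28)+(30); nothing about `ζ(5)`; `BarrierC2` unaffected. -/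
theorem ConeSupBound.floor {γs : ℝ} (h : ConeSupBound γs) : (870141 / 1000000 : ℝ) < γs :=
  h.lt_of_witness Line75Ray.line75Dir_mem_BZCone Line75Ray.regular_line75Dir
    Line75Ray.gamma_line75Dir_mem_unconditional.1

/-- No number `≤ 0.870141` is a cone sup bound. -/
theorem not_coneSupBound_of_le {γs : ℝ} (hle : γs ≤ 870141 / 1000000) : ¬ ConeSupBound γs :=
  fun h => lt_irrefl _ (h.floor.trans_le hle)

/-- **`¬ ConeSupBound 0.87`** — the kernel form of BARRIER-PLAN LEAD ADDENDUM 12: the cell wording «sup γ_28 < 0.87» is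
FALSIFIED at the MODEL tier by the witness direction (`γ(line75Dir) ∈ (0.870141, 0.870142)`); the headline of record was
re-worded WITHOUT a ceiling («`0.8701415 ≤ sup γ_28 < 1`», no numerical ceiling asserted). MODEL statement; nothing about `ζ(5)`. -/
theorem not_coneSupBound_087 : ¬ ConeSupBound (87 / 100) :=
  not_coneSupBound_of_le (by norm_num)

/-- `¬ ConeSupBound 0.867` — the coordinator's REFINED numerical target of 2026-08-23 («sup ≈ 0.867») is not a sup bound
either (it never was a claim of record; stated for completeness). -/
theorem not_coneSupBound_0867 : ¬ ConeSupBound (867 / 1000) :=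
  not_coneSupBound_of_le (by norm_num)

/-- The witness value exceeds `0.87`: `0.87 < γ(line75Dir)` (by-name probe for «the MODEL `γ_28` exceeds `0.87` at one explicit
direction of BZ's box»; `< 1` is `Line75Ray.gamma_line75Dir_lt_one`). -/
theorem Line75Ray.gamma_line75Dir_gt_087 : (87 / 100 : ℝ) < gamma Line75Ray.line75Dir :=
  lt_trans (by norm_num) Line75Ray.gamma_line75Dir_mem_unconditional.1

/-- The witness value is `< 1` (indeed `< 0.870142`): no irrationality content at this direction. -/
theorem Line75Ray.gamma_line75Dir_lt_one : gamma Line75Ray.line75Dir < 1 :=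
  lt_trans Line75Ray.gamma_line75Dir_mem_unconditional.2 (by norm_num)

/-- **C2 with its certified floor**: `BarrierC2 ↔ ∃ γ* ∈ (0.870141, 1), ConeSupBound γ*` — any eventual proof of C2 must
produce a `γ*` strictly between the witness floor and `1`. C2 remains OPEN; this is bookkeeping, not progress on C2. -/
theorem barrierC2_iff_exists_Ioo :
    BarrierC2 ↔ ∃ γs ∈ Ioo (870141 / 1000000 : ℝ) 1, ConeSupBound γs := by
  unfold BarrierC2
  constructor
  · rintro ⟨γs, hlt, h⟩
    exact ⟨γs, ⟨h.floor, hlt⟩, h⟩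
  · rintro ⟨γs, ⟨_, hlt⟩, h⟩
    exact ⟨γs, hlt, h⟩

/-- **The negation of C2, unfolded** (for the refuter side): `¬ BarrierC2` says that for EVERY `γ* < 1` some REGULAR direction
of the cone has `γ > γ*` — i.e. the MODEL sup over the regular cone is `1` (approached, since every computed `γ` is `< 1`).
Pure logic; no claim either way. -/
theorem not_barrierC2_iff :
    ¬ BarrierC2 ↔ ∀ γs : ℝ, γs < 1 → ∃ a ∈ BZCone, Regular a ∧ γs < gamma a := by
  unfold BarrierC2 ConeSupBound
  simp only [not_exists, not_and, not_forall, not_le, exists_prop]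

end Summit.KontsevichZagierPeriods.Zeta5Search.Barrier.ConeGamma
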